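import Literature.AlgebraicGeometry.Motives.HodgeStructureEndActionCompatibleSplittings
import Literature.AlgebraicGeometry.Motives.HodgeStructureLefschetzGroupCentralFieldSplitting
import HarnessLib

/-!
# Milne 1999 §2, type IV on points: `(C(A) ⊗_k k^al, †) = ∏_σ (C_σ, †)` with
# `C_σ ≈ End_Ē(V̄) ≈ M_m(k^al) × M_m(k^al)` AND `(α, β)† = (βᵗʳ, αᵗʳ)` — the centralizer algebra WITH ITS INVOLUTION,
# pair of blocks by pair of blocks, in dual bases of the two corners

[topic AlgebraicGeometry/Motives]

Layer `Literature/AlgebraicGeometry/Motives`, lane `lit-hodgefound` (Track 2 foundations library; seat `lit-hodgefound-p34`,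
generation 23, self-proposed row g23-#2 — free pointer (o) of the seat sheet; it discharges the "NOT here" items "the matrix form
`βᵗʳ`" of `Motives/HodgeStructureEndAlgCentralizerInvolutionBlocks`, "an explicit 'transpose of matrices' formula for `†` on
`∏ₜ M_m(K)` (it needs a choice of dual bases of the two corners)" of `Motives/HodgeStructureEndActionCompatibleSplittings`, and
"`(C(A), †)` as an algebra with involution — the involution pairs the factors of conjugate blocks" of
`Motives/HodgeStructureLefschetzGroupCentralFieldSplitting`). Milne's type IV model: `V̄ = V₁ ⊕ V₂`, `V₂ = V₁^∨`,
`Ē = M_d(k^al) × M_d(k^al)` with `(α, β)† = (βᵗʳ, αᵗʳ)`, and "for each `σ`, there exist compatible isomorphisms `E_σ → Ē`,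
`(V_σ, φ_σ) → (V̄, φ̄)` … Consequently, `C(A) ⊗_k k^al = ∏ C_σ` where `C_σ ≈ End_Ē(V̄) ≈ M_{g/fd}(k^al) × M_{g/fd}(k^al)`" — an
identification of `k^al`-algebras WITH INVOLUTION (`C(A)` "as a `k`-algebra with involution", §1). On `K`-points of the abstract
polarized `ℚ`-Hodge structure with a number field `F` acting centrally (`hcent`) and the Rosati condition
`Q(ι(a)v, w) = Q(v, ι(σa)w)`: for a representative block `V_{K,τₛ}` with a splitting `ρₛ : M_ι(K) → End_K(V_{K,τₛ})` of
`E_φ ⊗ K` and the COMPATIBLE splitting `ρₛ^† : M ↦ (ρₛ(Mᵀ))ᵀ` of the partner block `V_{K,τₛ∘σ}` (the seat's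
`Polarization.transposeSplitting`), the two corners `e V_{K,τₛ}` and `e^† V_{K,τₛ∘σ}` (`e = ρₛ(E_{i₀i₀})`, `e^† = ρₛ^†(E_{i₀i₀}) = eᵀ`)
are in PERFECT duality under `Q_K` (Milne's `φ₀ : V₁ × V₂ → k^al` on one copy of `S`), `†` restricted to the corners is the
transpose across this duality, in dual bases the matrices are transposed, and — re-indexing the `2·card Φ` blocks by `Φ ⊕ Φ`
and invoking the seat's `EndAction.centralizerBaseChangeAlgEquivCornerBlocks` — `C(H)(K) ≃ₐ[K] ∏_{s ∈ Φ} (M_m(K) × M_m(K))`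
carries `†` to `(α, β) ↦ (βᵀ, αᵀ)`. Definitions WITH BODIES (`pairingDualBasis`, `sumPiAlgEquivPiProd`,
`Polarization.cornerPairing`, `pairEmbedding`, `pairIndexEquiv`, `Polarization.pairSplitting`, `Polarization.centralizerAdjoint`,
`Polarization.centralizerBaseChangeAlgEquivCornerPairs`, `Polarization.centralizerBaseChangeAlgEquivMatrixPairs`) and theorems;
no named fact (net debt `0`).

## The source, verbatim

J. S. Milne, *Lefschetz classes on abelian varieties*, Duke Math. J. **96** (1999) 639–675 [Milne1999LefschetzClasses]
(held `paper:doi-10-1215-s0012-7094-99-09620-5`; Duke page = folio + 638):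
* (§1 p. 643 L5–L11) "`C(A)` is a `k`-algebra stable under the involution `†` defined by an ample divisor `D`, and the
  restriction of `†` to `C(A)` is independent of the choice of `D`. […] `C(A)`, as a `k`-algebra with involution, depends only on
  the isogeny class of `A`".
* (§2 Remark 2.3, p. 648 L13–L17) "the choice of an `E`-linear isomorphism `V → S^t` determines an isomorphism
  `C(E) = End_E(V) → M_t(Δ)`."
* (type IV, p. 650 L70 – p. 651 L21) "Let `V₂ = V₁^∨`. It has a natural structure of a right `M_d(k^al)`-module, which we turn
  into a left module structure by using the involution `α ↦ αᵗʳ`. The bilinear form `(x₁, x₂) ↦ φ₀(x₁, x₂) = x₂(x₁) :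
  V₁ × V₂ → k` has the property that `φ₀(αx₁, x₂) = φ₀(x₁, αᵗʳx₂)`. Set: `V̄ = V₁ ⊕ V₂`, `Ē = M_d(k^al) × M_d(k^al)`,
  `(α, β)† = (βᵗʳ, αᵗʳ)`, […] Then `†` is an involution on `Ē` […] and `φ̄(αx̄, ȳ) = φ̄(x̄, α†ȳ)`, all `α ∈ Ē`, `x̄, ȳ ∈ V̄`."
* (p. 651 L57–L70) "Using Remarks 2.2, 2.3, and 2.4, we find that, for each `σ`, there exist compatible isomorphisms
  `E_σ → Ē`, `(V_σ, φ_σ) → (V̄, φ̄)`, the first of which carries the Rosati involution on `E_σ` into the involution `†` on `Ē`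
  […] Consequently, `C(A) ⊗_k k^al = ∏ C_σ`, where `C_σ ≈ End_Ē(V̄) ≈ M_{g/fd}(k^al) × M_{g/fd}(k^al)`."

DICTIONARY. Milne's `σ : F → k^al` (embeddings of the totally real `F = K^†`) are the PAIRS `{τₛ, τₛ ∘ σ}`, represented by
`s ∈ Φ`; `V_σ = V₁ ⊕ V₂` is `V_{K,τₛ} ⊕ V_{K,τₛ∘σ}`; `Ē = M_d × M_d` acting on `V̄` is the compatible pair of splittings
`(ρₛ, ρₛ^†)`; `V₁ = S^{g/df}`, `V₂ = V₁^∨` are read through the corners: `V_{K,τₛ} ≅ (eV_{K,τₛ})^ι` and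
`e^†V_{K,τₛ∘σ} ≅ (eV_{K,τₛ})^∨` (the perfect corner pairing below); `C_σ ≈ End_Ē(V̄) ≈ M × M` is
`C_{τₛ} × C_{τₛ∘σ} ≃ End_K(eV_{K,τₛ}) × End_K(e^†V_{K,τₛ∘σ})` (Remark 2.3), and "`(α, β)† = (βᵗʳ, αᵗʳ)`" is: `†` maps the block of
`c ∈ C(H)(K)` on `V_{K,τₛ}` to the TRANSPOSE, across the corner pairing, of its block on `V_{K,τₛ∘σ}` and vice versa — as
matrices in dual bases, `(M₁, M₂) ↦ (M₂ᵀ, M₁ᵀ)`.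

## What is PROVED

* §0 (generic) DEF **`pairingDualBasis p hp b`** (the basis of `N` dual to a basis `b` of `M` across a perfect pairing
  `p : M × N → R`; `apply_pairingDualBasis`, `pairingDualBasis_repr`, `repr_eq_apply_pairingDualBasis`),
  **`toMatrix_pairingTranspose`** (in the bases `b`, `b^∨` the transpose `fᵀ` of `InvolutionBlocks.pairingTranspose` has matrix
  `(M_f)ᵀ`) and `toMatrix_pairingTranspose_flip`; DEF **`sumPiAlgEquivPiProd`** (`(∀ u : α ⊕ α, E u) ≃ₐ ∀ a, E(inl a) × E(inr a)`).
* §1 (one compatible pair `(ρ, ρ^†)`) `Polarization.unit_transposeSplitting` (`u^†_{ij} = (u_{ji})ᵀ`),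
  `Polarization.baseChange_form_unit_apply` (`Q_K(u_{ij}x, y) = Q_K(x, u^†_{ji}y)` — Milne's `φ₀(αx₁, x₂) = φ₀(x₁, αᵗʳx₂)`),
  DEF **`Polarization.cornerPairing … s ρ i₀ : eV_{K,τₛ} →ₗ e^†V_{K,τₛ∘σ} →ₗ K`** (`Q_K` restricted, `_apply` rfl) and
  **`Polarization.isPerfPair_cornerPairing`** (`e^†V₂ = (eV₁)^∨`).
* §2 `EndAction.mem_centralizer_range_of_splitting` (an element of the commutant `C_χ` commutes with `ρ(M_ι(K))`),
  `EndAction.restrictBlock_mul_unit` / `Polarization.restrictBlock_adjointBaseChange_mul_unit` (the blocks of `c`, `c†` commute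
  with the matrix units of `ρ`, `ρ^†`), **`Polarization.cornerRestrict_adjointBaseChange_eq_pairingTranspose`**
  (`c†|e^†V_{K,τₛ∘σ} = (c|eV_{K,τₛ})ᵀ` across the corner pairing) and **`…_eq_pairingTranspose_flip`**
  (`c†|eV_{K,τₛ} = (c|e^†V_{K,τₛ∘σ})ᵀ`), for every `c` commuting with `E_φ ⊗ K`; in dual bases
  **`Polarization.toMatrix_cornerRestrict_adjointBaseChange`** / **`…_flip`**: the matrices are TRANSPOSED.
* §3 (all pairs, `Φ ⊕ Φ` re-indexing) DEF `pairEmbedding τ σ Φ : Φ ⊕ Φ → Hom(F, K)` (`inl s ↦ τₛ`, `inr s ↦ τₛ ∘ σ`;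
  `pairEmbedding_injective`), `partnerIndex_partnerIndex` (the index involution is an involution), DEF `pairIndexEquiv : Φ ⊕ Φ ≃ S`,
  `card_sum_eq_finrank`, DEF `Polarization.pairSplitting` (`ρₛ` on `V_{K,τₛ}`, `ρₛ^†` on `V_{K,τₛ∘σ}`),
  `Polarization.span_blockOp_pairEmbedding_eq_range`, DEF **`Polarization.centralizerAdjoint`** (`†` on `C(H)(K)`;
  `coe_centralizerAdjoint`, `centralizerAdjoint_centralizerAdjoint`, `centralizerAdjoint_mul`), DEF
  **`Polarization.centralizerBaseChangeAlgEquivCornerPairs : C(H)(K) ≃ₐ[K] ∏_{s ∈ Φ} (End_K(eV_{K,τₛ}) × End_K(e^†V_{K,τₛ∘σ}))`**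
  (`c ↦ (c|eV_{K,τₛ}, c|e^†V_{K,τₛ∘σ})_s`; `coe_…_apply_fst/_snd` rfl) and the involution formula
  **`Polarization.centralizerBaseChangeAlgEquivCornerPairs_centralizerAdjoint`**:
  `Ψ(c†)ₛ = (((Ψ c)ₛ.2)ᵀ, ((Ψ c)ₛ.1)ᵀ)` (transposes across the corner pairing and its flip).
* §4 (matrices) DEF **`Polarization.centralizerBaseChangeAlgEquivMatrixPairs : C(H)(K) ≃ₐ[K] ∏_{s ∈ Φ} (M_m(K) × M_m(K))`**
  (bases `bₛ` of the corners and their duals `bₛ^∨`), **`Polarization.centralizerBaseChangeAlgEquivMatrixPairs_centralizerAdjoint`**: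
  `Ψ(c†)ₛ = ((Ψ c)ₛ.2ᵀ, (Ψ c)ₛ.1ᵀ)` — "`(α, β)† = (βᵗʳ, αᵗʳ)`"; and OUTRIGHT over an algebraically closed `K` for `E_φ` simple
  with centre exactly the central `ι(F)`: **`Polarization.exists_centralizer_algEquiv_matrixPairs_adjoint`** — `∃ d ≥ 1`,
  `d²·[F:ℚ] = dim_ℚ E_φ`, `d ∣ dim_ℚ V/[F:ℚ]`, and `Ψ : C(H)(K) ≃ₐ[K] ∏_{s ∈ Φ} (M_m(K) × M_m(K))`, `m = dim_ℚ V/[F:ℚ]/d`, with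
  `Ψ(c†)ₛ = ((Ψ c)ₛ.2ᵀ, (Ψ c)ₛ.1ᵀ)` for all `c ∈ C(H)(K)` — "`C(A) ⊗_k k^al = ∏_σ C_σ`, `C_σ ≈ M_{g/fd}(k^al) × M_{g/fd}(k^al)`,
  `(α, β)† = (βᵗʳ, αᵗʳ)`".

NOT here (honest): the form `φ̄` on `V̄` and the compatibility `(V_σ, φ_σ) → (V̄, φ̄)` beyond the corner duality `φ₀`
(the Hermitian structure over `K̄ = k^al × k^al` is not packaged); positivity of the involution; the rational structure over a
non-closed `k` and Milne's `E` being a central DIVISION algebra over a CM centre (Albert) — hypotheses `hcent`, `hcen`,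
`[IsSimpleRing E_φ]`, `hros` as in the seat's type IV files; the existence of the splittings over a non-closed `K`. HC is NOT
proved; nothing here claims a case of the Hodge conjecture.

## References

* [Milne1999LefschetzClasses] J. S. Milne, *Lefschetz classes on abelian varieties*, Duke Math. J. 96 (1999) 639–675 — §1
  p. 643 (`C(A)` with its involution), §2 Remarks 2.2–2.4 (pp. 647–648), pp. 650–651 (type IV: `V̄`, `Ē`, `(α, β)† = (βᵗʳ, αᵗʳ)`,
  "`C(A) ⊗_k k^al = ∏ C_σ`, `C_σ ≈ M × M`").
* [Deligne1982HodgeCycles] P. Deligne, *Hodge cycles on abelian varieties*, LNM 900 (1982) — §4 (the decomposition along the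
  action of a CM field and its pairing under a polarization).
* [KnusEtAl1998] M.-A. Knus, A. Merkurjev, M. Rost, J.-P. Tignol, *The Book of Involutions*, AMS Colloquium Publications 44
  (1998), Ch. I §4.A (Morita theory for `M_m(R)`-modules with forms; Milne's "Knus 1991, I.9.5").
-/

noncomputable section

open scoped TensorProduct Matrix
open Function Module

namespace Literature.AlgebraicGeometry.Motives

open Literature.LinearAlgebra.Matrix (MatrixAlgAction.unit MatrixAlgAction.unit_def MatrixAlgAction.corner
  MatrixAlgAction.unit_apply_coe_corner MatrixAlgAction.unit_apply_mem_corner MatrixAlgAction.mem_centralizer_range_iff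
  MatrixAlgAction.cornerRestrict MatrixAlgAction.coe_cornerRestrict_apply)

/-! ## §0 Generic: the dual basis across a perfect pairing, the matrix of the transpose, a re-indexing of products over `α ⊕ α` -/

section PairingDualBasis

variable {R : Type*} [CommRing R] {M : Type*} {N : Type*} [AddCommGroup M] [Module R M] [AddCommGroup N] [Module R N]
  (p : M →ₗ[R] N →ₗ[R] R) (hp : p.IsPerfPair) {ι : Type*} [Fintype ι] [DecidableEq ι] (b : Module.Basis ι R M)

/-- **The basis `b^∨` of `N` dual to a basis `b` of `M` across a perfect pairing `p : M × N → R`** (`p(bᵢ, b^∨ⱼ) = δᵢⱼ`): the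
dual basis of `M^∨` transported along `N ≃ M^∨`, `y ↦ p(·, y)` — the coordinates in which Milne's `V₂ = V₁^∨` is read.
[cite: Milne1999LefschetzClasses, §2 p. 650 L72 – p. 651 L2 ("V₂ = V₁^∨ … φ₀(x₁, x₂) = x₂(x₁)")]
-- TODO(move): generic linear algebra (`LinearAlgebra/PerfectPairing`). -/
def pairingDualBasis : Module.Basis ι R N :=
  haveI := hp
  b.dualBasis.map p.flip.toPerfPair.symm

/-- **`p(bᵢ, b^∨ⱼ) = δᵢⱼ`.** [cite: Milne1999LefschetzClasses, §2 p. 651 L1–L2 ("φ₀(x₁, x₂) = x₂(x₁)")] -/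
theorem apply_pairingDualBasis (i j : ι) : p (b i) (pairingDualBasis p hp b j) = if i = j then 1 else 0 := by
  haveI := hp
  rw [pairingDualBasis, Module.Basis.map_apply, ← LinearMap.flip_apply (f := p), LinearMap.apply_symm_toPerfPair_self,
    Module.Basis.dualBasis_apply_self]

/-- **The coordinates of `y ∈ N` in `b^∨` are `p(bᵢ, y)`.** [cite: Milne1999LefschetzClasses, §2 p. 651 L1–L2] -/
theorem pairingDualBasis_repr (y : N) (i : ι) : (pairingDualBasis p hp b).repr y i = p (b i) y := by
  haveI := hp
  rw [pairingDualBasis, Module.Basis.map_repr, LinearEquiv.trans_apply, LinearEquiv.symm_symm, Module.Basis.dualBasis_repr,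
    LinearMap.toPerfPair_apply, LinearMap.flip_apply]

/-- **The coordinates of `x ∈ M` in `b` are `p(x, b^∨ⱼ)`.** [cite: Milne1999LefschetzClasses, §2 p. 651 L1–L2] -/
theorem repr_eq_apply_pairingDualBasis (x : M) (j : ι) : b.repr x j = p x (pairingDualBasis p hp b j) := by
  haveI := hp
  rw [pairingDualBasis, Module.Basis.map_apply, ← LinearMap.flip_apply (f := p), LinearMap.apply_symm_toPerfPair_self,
    Module.Basis.dualBasis_apply]

/-- **In the bases `b` of `M` and `b^∨` of `N`, the transpose `fᵀ` across `p` has matrix `(M_f)ᵀ`** — Milne's `α ↦ αᵗʳ` on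
`V₂ = V₁^∨` IS matrix transposition in dual coordinates. [cite: Milne1999LefschetzClasses, §2 p. 650 L72 – p. 651 L8 ("using the involution α ↦ αᵗʳ … (α, β)† = (βᵗʳ, αᵗʳ)")] -/
theorem toMatrix_pairingTranspose (f : Module.End R M) :
    LinearMap.toMatrix (pairingDualBasis p hp b) (pairingDualBasis p hp b) (pairingTranspose p hp f) =
      (LinearMap.toMatrix b b f)ᵀ := by
  ext i j
  rw [LinearMap.toMatrix_apply, Matrix.transpose_apply, LinearMap.toMatrix_apply, pairingDualBasis_repr, apply_pairingTranspose,
    repr_eq_apply_pairingDualBasis p hp b]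

/-- The same across the flipped pairing: for `g ∈ End(N)`, the transpose `gᵀ ∈ End(M)` has, in `b`, the matrix `(M_g)ᵀ` where
`M_g` is the matrix of `g` in `b^∨`. [cite: Milne1999LefschetzClasses, §2 p. 651 L5–L8 ("(α, β)† = (βᵗʳ, αᵗʳ)")] -/
theorem toMatrix_pairingTranspose_flip (g : Module.End R N) :
    LinearMap.toMatrix b b (pairingTranspose p.flip hp.flip g) =
      (LinearMap.toMatrix (pairingDualBasis p hp b) (pairingDualBasis p hp b) g)ᵀ := by
  ext i j
  rw [LinearMap.toMatrix_apply, Matrix.transpose_apply, LinearMap.toMatrix_apply, repr_eq_apply_pairingDualBasis p hp b,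
    ← LinearMap.flip_apply (f := p), apply_pairingTranspose, LinearMap.flip_apply, pairingDualBasis_repr]

end PairingDualBasis

section SumPi

variable {α : Type*} (R : Type*) [CommSemiring R] (E : α ⊕ α → Type*) [∀ u, Semiring (E u)] [∀ u, Algebra R (E u)]

/-- **Re-indexing a product of algebras over `α ⊕ α` by pairs: `(∏_{u : α ⊕ α} E u) ≃ₐ ∏_{a} (E(inl a) × E(inr a))`** — the
bookkeeping behind "`C(A) ⊗_k k^al = ∏_σ C_σ`" with `σ` running over the PAIRS of conjugate embeddings (`C_σ` collects the two
blocks `V₁`, `V₂` of a pair). [cite: Milne1999LefschetzClasses, §2 p. 651 L64–L70 ("C(A) ⊗_k k^al = ∏ C_σ, C_σ ≈ M × M")]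
-- TODO(move): generic algebra (`Algebra/Algebra/Pi`). -/
def sumPiAlgEquivPiProd : (∀ u, E u) ≃ₐ[R] ∀ a, E (.inl a) × E (.inr a) where
  toFun f a := (f (.inl a), f (.inr a))
  invFun g u := Sum.rec (motive := fun u => E u) (fun a => (g a).1) (fun a => (g a).2) u
  left_inv f := funext fun u => by cases u <;> rfl
  right_inv _ := rfl
  map_mul' _ _ := rfl
  map_add' _ _ := rfl
  commutes' _ := rfl

/-- Unfolding. [cite: Milne1999LefschetzClasses, §2 p. 651 L64–L70] -/
@[simp] theorem sumPiAlgEquivPiProd_apply (f : ∀ u, E u) (a : α) :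
    sumPiAlgEquivPiProd R E f a = (f (.inl a), f (.inr a)) :=
  rfl

end SumPi

namespace HodgeStructure

universe u uK

variable {V : Type u} [AddCommGroup V] [Module ℚ V] {n : ℤ} {H : HodgeStructure V n}
variable {F : Type*} [Field F] [NumberField F]
variable (K : Type uK) [Field K] [Algebra ℚ K] (A : EndAction H F) {S : Type*} (τ : S → (F →ₐ[ℚ] K))
variable (Q : Polarization H) (σ : F ≃ₐ[ℚ] F)
variable [Fintype S] [Module.Finite ℚ V] (κ : S → S) (Φ : Finset S)
variable (hτ : Injective τ) (hcard : Fintype.card S = finrank ℚ F)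
  (hros : ∀ a v w, Q.form (A.ι a v) w = Q.form v (A.ι (σ a) w)) (hσ : ∀ a, σ (σ a) = a)
  (hκ : ∀ s, τ (κ s) = (τ s).comp (σ : F →ₐ[ℚ] F))
  (hΦ₁ : ∀ s, s ∈ Φ ∨ κ s ∈ Φ) (hΦ₂ : ∀ s ∈ Φ, κ s ∉ Φ)
  (hcent : ∀ a ∈ H.endAlg, ∀ f : F, a * A.ι f = A.ι f * a)
variable {ι : Type*} [Fintype ι] [DecidableEq ι]

/-! ## §1 One compatible pair `(ρ, ρ^†)`: the corner pairing `Q_K : e V_{K,τₛ} × e^† V_{K,τₛ∘σ} → K` is perfect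
("`V₂ = V₁^∨`, `φ₀(x₁, x₂) = x₂(x₁)`, `φ₀(αx₁, x₂) = φ₀(x₁, αᵗʳx₂)`") -/

section OnePair

variable (s : S) (ρ : Matrix ι ι K →ₐ[K] A.BlockEnd K (τ s))

/-- **The matrix units of the compatible splitting are the transposed units: `u^†_{ij} = (u_{ji})ᵀ`** (`ρ^†(E_{ij}) = (ρ(E_{ij}ᵀ))ᵀ =
(ρ(E_{ji}))ᵀ`). [cite: Milne1999LefschetzClasses, §2 p. 650 L72–L74 ("we turn [V₁^∨] into a left module structure by using the involution α ↦ αᵗʳ")] -/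
theorem Polarization.unit_transposeSplitting (i j : ι) :
    MatrixAlgAction.unit (Q.transposeSplitting K A τ σ κ hτ hcard hros hσ hκ s ρ) i j =
      Q.blockTranspose K A τ σ κ hτ hcard hros hσ hκ s (MatrixAlgAction.unit ρ j i) := by
  rw [MatrixAlgAction.unit_def, MatrixAlgAction.unit_def, Q.transposeSplitting_apply K A τ σ κ hτ hcard hros hσ hκ,
    Matrix.transpose_single]

/-- **`Q_K(u_{ij} x, y) = Q_K(x, u^†_{ji} y)`** for `x ∈ V_{K,τₛ}`, `y ∈ V_{K,τₛ∘σ}` — Milne's `φ₀(αx₁, x₂) = φ₀(x₁, αᵗʳx₂)` on the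
matrix units. [cite: Milne1999LefschetzClasses, §2 p. 651 L1–L5 ("φ₀(αx₁, x₂) = φ₀(x₁, αᵗʳ x₂)")] -/
theorem Polarization.baseChange_form_unit_apply (i j : ι) (x : A.eigenspaceBaseChange K (τ s))
    (y : A.eigenspaceBaseChange K ((τ s).comp (σ : F →ₐ[ℚ] F))) :
    Q.form.baseChange K ((MatrixAlgAction.unit ρ i j x : A.eigenspaceBaseChange K (τ s)) : K ⊗[ℚ] V) (y : K ⊗[ℚ] V) =
      Q.form.baseChange K (x : K ⊗[ℚ] V)
        ((MatrixAlgAction.unit (Q.transposeSplitting K A τ σ κ hτ hcard hros hσ hκ s ρ) j i y :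
          A.eigenspaceBaseChange K ((τ s).comp (σ : F →ₐ[ℚ] F))) : K ⊗[ℚ] V) := by
  rw [Q.unit_transposeSplitting K A τ σ κ hτ hcard hros hσ hκ s ρ, Q.baseChange_form_apply_blockTranspose K A τ σ κ hτ hcard hros hσ hκ]

variable (i₀ : ι)

/-- **The corner pairing `Q_K : e V_{K,τₛ} × e^† V_{K,τₛ∘σ} → K`** (`e = u_{i₀i₀}`, `e^† = u^†_{i₀i₀} = eᵀ`): Milne's
`φ₀ : V₁ × V₂ → k^al`, "`φ₀(x₁, x₂) = x₂(x₁)`", on one copy of the simple module `S`. [cite: Milne1999LefschetzClasses, §2 p. 650 L76 – p. 651 L2] -/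
def Polarization.cornerPairing :
    MatrixAlgAction.corner ρ i₀ →ₗ[K] MatrixAlgAction.corner (Q.transposeSplitting K A τ σ κ hτ hcard hros hσ hκ s ρ) i₀ →ₗ[K] K :=
  (Q.blockPairing K A (τ s) ((τ s).comp (σ : F →ₐ[ℚ] F))).compl₁₂
    (MatrixAlgAction.corner ρ i₀).subtype (MatrixAlgAction.corner (Q.transposeSplitting K A τ σ κ hτ hcard hros hσ hκ s ρ) i₀).subtype

/-- `cornerPairing x y = Q_K(x, y)`. [cite: Milne1999LefschetzClasses, §2 p. 651 L1–L2] -/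
@[simp] theorem Polarization.cornerPairing_apply (x : MatrixAlgAction.corner ρ i₀)
    (y : MatrixAlgAction.corner (Q.transposeSplitting K A τ σ κ hτ hcard hros hσ hκ s ρ) i₀) :
    Q.cornerPairing K A τ σ κ hτ hcard hros hσ hκ s ρ i₀ x y =
      Q.form.baseChange K ((x : A.eigenspaceBaseChange K (τ s)) : K ⊗[ℚ] V)
        ((y : A.eigenspaceBaseChange K ((τ s).comp (σ : F →ₐ[ℚ] F))) : K ⊗[ℚ] V) :=
  rfl

/-- **The corner pairing is PERFECT: `e^† V_{K,τₛ∘σ} = (e V_{K,τₛ})^∨`** — Milne's "`V₂ = V₁^∨`" on one copy of `S`: a vector of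
`eV₁` orthogonal to `e^†V₂` is orthogonal to all of `V₂` (`Q_K(x, y) = Q_K(ex, y) = Q_K(x, e^†y)`), hence `0` by the perfect
pairing `V₁ × V₂ → K` of Remark 2.2, and symmetrically. [cite: Milne1999LefschetzClasses, §2 p. 650 L72 – p. 651 L2 ("Let V₂ = V₁^∨") and Remark 2.2 (p. 647 L66–L69)] -/
theorem Polarization.isPerfPair_cornerPairing : (Q.cornerPairing K A τ σ κ hτ hcard hros hσ hκ s ρ i₀).IsPerfPair := by
  have hperf := Q.isPerfPair_blockPairing K A τ σ κ hτ hcard hros hσ hκ s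
  refine LinearMap.IsPerfPair.of_injective ?_ ?_
  · rw [injective_iff_map_eq_zero]
    intro x hx
    have h1 : ∀ y : A.eigenspaceBaseChange K ((τ s).comp (σ : F →ₐ[ℚ] F)),
        Q.form.baseChange K ((x : A.eigenspaceBaseChange K (τ s)) : K ⊗[ℚ] V) (y : K ⊗[ℚ] V) = 0 := fun y => by
      have h := LinearMap.congr_fun hx
        ⟨_, MatrixAlgAction.unit_apply_mem_corner (Q.transposeSplitting K A τ σ κ hτ hcard hros hσ hκ s ρ) i₀ i₀ y⟩
      simp only [Q.cornerPairing_apply K A τ σ κ hτ hcard hros hσ hκ s ρ i₀, LinearMap.zero_apply] at h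
      rw [← Q.baseChange_form_unit_apply K A τ σ κ hτ hcard hros hσ hκ s ρ, MatrixAlgAction.unit_apply_coe_corner ρ x] at h
      exact h
    have h2 : (x : A.eigenspaceBaseChange K (τ s)) = 0 :=
      hperf.bijective_left.injective (LinearMap.ext fun y => by
        rw [map_zero, LinearMap.zero_apply, Q.blockPairing_apply K A]; exact h1 y)
    exact Subtype.ext h2
  · rw [injective_iff_map_eq_zero]
    intro y hy
    have h1 : ∀ x : A.eigenspaceBaseChange K (τ s), Q.form.baseChange K (x : K ⊗[ℚ] V)
        ((y : A.eigenspaceBaseChange K ((τ s).comp (σ : F →ₐ[ℚ] F))) : K ⊗[ℚ] V) = 0 := fun x => by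
      have h := LinearMap.congr_fun hy ⟨_, MatrixAlgAction.unit_apply_mem_corner ρ i₀ i₀ x⟩
      simp only [LinearMap.flip_apply, Q.cornerPairing_apply K A τ σ κ hτ hcard hros hσ hκ s ρ i₀, LinearMap.zero_apply] at h
      rw [Q.baseChange_form_unit_apply K A τ σ κ hτ hcard hros hσ hκ s ρ,
        MatrixAlgAction.unit_apply_coe_corner (Q.transposeSplitting K A τ σ κ hτ hcard hros hσ hκ s ρ) y] at h
      exact h
    have h2 : (y : A.eigenspaceBaseChange K ((τ s).comp (σ : F →ₐ[ℚ] F))) = 0 :=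
      hperf.bijective_right.injective (LinearMap.ext fun x => by
        rw [map_zero, LinearMap.zero_apply, LinearMap.flip_apply, Q.blockPairing_apply K A]; exact h1 x)
    exact Subtype.ext h2

/-- **`dim_K e^† V_{K,τₛ∘σ} = dim_K e V_{K,τₛ}`** (`= g/df`): the two corners are in perfect duality. [cite: Milne1999LefschetzClasses, §2 p. 650 L72 – p. 651 L2 and L70 ("M_{g/fd}(k^al) × M_{g/fd}(k^al)")] -/
theorem Polarization.finrank_corner_transposeSplitting :
    finrank K (MatrixAlgAction.corner (Q.transposeSplitting K A τ σ κ hτ hcard hros hσ hκ s ρ) i₀) =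
      finrank K (MatrixAlgAction.corner ρ i₀) :=
  haveI := Q.isPerfPair_cornerPairing K A τ σ κ hτ hcard hros hσ hκ s ρ i₀
  (Module.finrank_of_isPerfPair (Q.cornerPairing K A τ σ κ hτ hcard hros hσ hκ s ρ i₀)).symm

/-! ## §2 `†` on the corners of a compatible pair is TRANSPOSITION across the corner pairing ("`(α, β)† = (βᵗʳ, αᵗʳ)`"), and in
dual bases the matrices are transposed -/

omit [Fintype S] [Module.Finite ℚ V] in
/-- An element of the commutant `C_χ` of the restricted operators commutes with a splitting `ρ(M_ι(K)) = K·(E_φ|V_{K,χ})`.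
[cite: Milne1999LefschetzClasses, §2 Remark 2.3 ("the centralizer C(E) of E in End_k(V)")] -/
theorem EndAction.mem_centralizer_range_of_splitting {χ : F →ₐ[ℚ] K} (ρ' : Matrix ι ι K →ₐ[K] A.BlockEnd K χ)
    (hρ' : Submodule.span K (Set.range (A.blockOp K hcent χ)) = LinearMap.range ρ'.toLinearMap) {f : A.BlockEnd K χ}
    (hf : f ∈ Subalgebra.centralizer K (Set.range (A.blockOp K hcent χ))) : f ∈ Subalgebra.centralizer K (Set.range ρ') := by
  have hset : Subalgebra.centralizer K (Set.range (A.blockOp K hcent χ)) = Subalgebra.centralizer K (Set.range ρ') := by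
    rw [← centralizer_coe_span K (Set.range (A.blockOp K hcent χ)), hρ', LinearMap.coe_range,
      ← centralizer_coe_span K (Set.range ρ')]
    congr 1
    exact congrArg SetLike.coe (Submodule.span_eq (LinearMap.range ρ'.toLinearMap)).symm
  exact hset ▸ hf

variable {c : Module.End K (K ⊗[ℚ] V)}
  (hc : ∀ a : H.endAlg, (a : Module.End ℚ V).baseChange K * c = c * (a : Module.End ℚ V).baseChange K)
  (hρ : Submodule.span K (Set.range (A.blockOp K hcent (τ s))) = LinearMap.range ρ.toLinearMap)

omit [Fintype S] [Module.Finite ℚ V] in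
include hρ in
/-- **The block `c|V_{K,τₛ}` of an operator commuting with `E_φ ⊗ K` commutes with the matrix units `u_{kl} = ρ(E_{kl})`.**
[cite: Milne1999LefschetzClasses, §2 Remark 2.3 and p. 651 L64–L70] -/
theorem EndAction.restrictBlock_mul_unit (k l : ι) :
    A.restrictBlock K c hc (τ s) * MatrixAlgAction.unit ρ k l = MatrixAlgAction.unit ρ k l * A.restrictBlock K c hc (τ s) :=
  (MatrixAlgAction.mem_centralizer_range_iff ρ _).1
    (A.mem_centralizer_range_of_splitting K hcent ρ hρ (A.restrictBlock_mem_centralizer_blockOp K hcent hc (τ s))) k l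

include hρ in
/-- **The block `c†|V_{K,τₛ∘σ}` commutes with the matrix units `u^†_{kl}` of the compatible splitting** (`c†` commutes with
`E_φ ⊗ K` since `E_φ† = E_φ`, and `ρ^†(M_ι(K)) = K·(E_φ|V_{K,τₛ∘σ})`). [cite: Milne1999LefschetzClasses, §1 p. 643 L5–L6 ("C(A) is … stable under the involution †") and §2 p. 651 L57–L64] -/
theorem Polarization.restrictBlock_adjointBaseChange_mul_unit (k l : ι) :
    A.restrictBlock K (Q.adjointBaseChange K c) (Q.forall_baseChange_comp_adjointBaseChange_of_forall_comm K hc)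
          ((τ s).comp (σ : F →ₐ[ℚ] F)) * MatrixAlgAction.unit (Q.transposeSplitting K A τ σ κ hτ hcard hros hσ hκ s ρ) k l =
      MatrixAlgAction.unit (Q.transposeSplitting K A τ σ κ hτ hcard hros hσ hκ s ρ) k l *
        A.restrictBlock K (Q.adjointBaseChange K c) (Q.forall_baseChange_comp_adjointBaseChange_of_forall_comm K hc)
          ((τ s).comp (σ : F →ₐ[ℚ] F)) :=
  (MatrixAlgAction.mem_centralizer_range_iff (Q.transposeSplitting K A τ σ κ hτ hcard hros hσ hκ s ρ) _).1
    (A.mem_centralizer_range_of_splitting K hcent _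
      (Q.span_blockOp_eq_range_transposeSplitting K A τ σ κ hτ hcard hros hσ hκ hcent s ρ hρ)
      (A.restrictBlock_mem_centralizer_blockOp K hcent _ _)) k l

/-- **`c†|e^†V_{K,τₛ∘σ} = (c|eV_{K,τₛ})ᵀ` across the corner pairing** — Milne's "`(α, β)† = (βᵗʳ, αᵗʳ)`", second component: for any
`c` commuting with `E_φ ⊗ K` whose blocks commute with the matrix units (`hcs`, `hc's`), the corner restriction of `c†` on the
partner corner is the transpose of the corner restriction of `c` (`Q_K(x, c†y) = Q_K(cx, y)`).
[cite: Milne1999LefschetzClasses, §2 p. 651 L5–L8 ("(α, β)† = (βᵗʳ, αᵗʳ)") and §1 p. 642 L64–L68 ("e_D(βx, y) = e_D(x, β†y)")] -/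
theorem Polarization.cornerRestrict_adjointBaseChange_eq_pairingTranspose
    (hcs : ∀ k l, A.restrictBlock K c hc (τ s) * MatrixAlgAction.unit ρ k l = MatrixAlgAction.unit ρ k l * A.restrictBlock K c hc (τ s))
    (hc's : ∀ k l, A.restrictBlock K (Q.adjointBaseChange K c) (Q.forall_baseChange_comp_adjointBaseChange_of_forall_comm K hc)
          ((τ s).comp (σ : F →ₐ[ℚ] F)) * MatrixAlgAction.unit (Q.transposeSplitting K A τ σ κ hτ hcard hros hσ hκ s ρ) k l =
      MatrixAlgAction.unit (Q.transposeSplitting K A τ σ κ hτ hcard hros hσ hκ s ρ) k l *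
        A.restrictBlock K (Q.adjointBaseChange K c) (Q.forall_baseChange_comp_adjointBaseChange_of_forall_comm K hc)
          ((τ s).comp (σ : F →ₐ[ℚ] F))) :
    MatrixAlgAction.cornerRestrict i₀ _ hc's =
      pairingTranspose (Q.cornerPairing K A τ σ κ hτ hcard hros hσ hκ s ρ i₀)
        (Q.isPerfPair_cornerPairing K A τ σ κ hτ hcard hros hσ hκ s ρ i₀) (MatrixAlgAction.cornerRestrict i₀ _ hcs) :=
  pairingTranspose_unique _ (Q.isPerfPair_cornerPairing K A τ σ κ hτ hcard hros hσ hκ s ρ i₀) fun x y => by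
    rw [Q.cornerPairing_apply K A τ σ κ hτ hcard hros hσ hκ s ρ i₀, Q.cornerPairing_apply K A τ σ κ hτ hcard hros hσ hκ s ρ i₀, MatrixAlgAction.coe_cornerRestrict_apply,
      MatrixAlgAction.coe_cornerRestrict_apply, EndAction.coe_restrictBlock_apply, EndAction.coe_restrictBlock_apply]
    exact Q.baseChange_form_apply_adjointBaseChange K c _ _

/-- **`c†|eV_{K,τₛ} = (c|e^†V_{K,τₛ∘σ})ᵀ` across the flipped corner pairing** — Milne's "`(α, β)† = (βᵗʳ, αᵗʳ)`", first component
(`Q_K(c†x, y) = Q_K(x, cy)`). [cite: Milne1999LefschetzClasses, §2 p. 651 L5–L8 and §1 p. 642 L64–L70] -/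
theorem Polarization.cornerRestrict_adjointBaseChange_eq_pairingTranspose_flip
    (hcs : ∀ k l, A.restrictBlock K c hc ((τ s).comp (σ : F →ₐ[ℚ] F)) *
        MatrixAlgAction.unit (Q.transposeSplitting K A τ σ κ hτ hcard hros hσ hκ s ρ) k l =
      MatrixAlgAction.unit (Q.transposeSplitting K A τ σ κ hτ hcard hros hσ hκ s ρ) k l *
        A.restrictBlock K c hc ((τ s).comp (σ : F →ₐ[ℚ] F)))
    (hc's : ∀ k l, A.restrictBlock K (Q.adjointBaseChange K c) (Q.forall_baseChange_comp_adjointBaseChange_of_forall_comm K hc)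
        (τ s) * MatrixAlgAction.unit ρ k l =
      MatrixAlgAction.unit ρ k l *
        A.restrictBlock K (Q.adjointBaseChange K c) (Q.forall_baseChange_comp_adjointBaseChange_of_forall_comm K hc) (τ s)) :
    MatrixAlgAction.cornerRestrict i₀ _ hc's =
      pairingTranspose (Q.cornerPairing K A τ σ κ hτ hcard hros hσ hκ s ρ i₀).flip
        (Q.isPerfPair_cornerPairing K A τ σ κ hτ hcard hros hσ hκ s ρ i₀).flip (MatrixAlgAction.cornerRestrict i₀ _ hcs) :=
  pairingTranspose_unique _ (Q.isPerfPair_cornerPairing K A τ σ κ hτ hcard hros hσ hκ s ρ i₀).flip fun y x => by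
    rw [LinearMap.flip_apply, LinearMap.flip_apply, Q.cornerPairing_apply K A τ σ κ hτ hcard hros hσ hκ s ρ i₀, Q.cornerPairing_apply K A τ σ κ hτ hcard hros hσ hκ s ρ i₀,
      MatrixAlgAction.coe_cornerRestrict_apply, MatrixAlgAction.coe_cornerRestrict_apply, EndAction.coe_restrictBlock_apply,
      EndAction.coe_restrictBlock_apply]
    exact Q.baseChange_form_adjointBaseChange_apply K c _ _

variable {m : Type*} [Fintype m] [DecidableEq m] (b : Module.Basis m K (MatrixAlgAction.corner ρ i₀))

/-- **In dual bases the matrices are TRANSPOSED: `M(c†|e^†V₂) = M(c|eV₁)ᵀ`** (`b` a basis of `eV_{K,τₛ}`, `b^∨` its dual basis of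
`e^†V_{K,τₛ∘σ}` across the corner pairing). [cite: Milne1999LefschetzClasses, §2 p. 651 L5–L8 ("(α, β)† = (βᵗʳ, αᵗʳ)")] -/
theorem Polarization.toMatrix_cornerRestrict_adjointBaseChange
    (hcs : ∀ k l, A.restrictBlock K c hc (τ s) * MatrixAlgAction.unit ρ k l = MatrixAlgAction.unit ρ k l * A.restrictBlock K c hc (τ s))
    (hc's : ∀ k l, A.restrictBlock K (Q.adjointBaseChange K c) (Q.forall_baseChange_comp_adjointBaseChange_of_forall_comm K hc)
          ((τ s).comp (σ : F →ₐ[ℚ] F)) * MatrixAlgAction.unit (Q.transposeSplitting K A τ σ κ hτ hcard hros hσ hκ s ρ) k l =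
      MatrixAlgAction.unit (Q.transposeSplitting K A τ σ κ hτ hcard hros hσ hκ s ρ) k l *
        A.restrictBlock K (Q.adjointBaseChange K c) (Q.forall_baseChange_comp_adjointBaseChange_of_forall_comm K hc)
          ((τ s).comp (σ : F →ₐ[ℚ] F))) :
    LinearMap.toMatrix
        (pairingDualBasis _ (Q.isPerfPair_cornerPairing K A τ σ κ hτ hcard hros hσ hκ s ρ i₀) b)
        (pairingDualBasis _ (Q.isPerfPair_cornerPairing K A τ σ κ hτ hcard hros hσ hκ s ρ i₀) b)
        (MatrixAlgAction.cornerRestrict i₀ _ hc's) =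
      (LinearMap.toMatrix b b (MatrixAlgAction.cornerRestrict i₀ _ hcs))ᵀ := by
  rw [Q.cornerRestrict_adjointBaseChange_eq_pairingTranspose K A τ σ κ hτ hcard hros hσ hκ s ρ i₀ hc hcs hc's]
  exact toMatrix_pairingTranspose _ (Q.isPerfPair_cornerPairing K A τ σ κ hτ hcard hros hσ hκ s ρ i₀) b _

/-- **And `M(c†|eV₁) = M(c|e^†V₂)ᵀ`** (matrix of `c†|eV_{K,τₛ}` in `b` versus matrix of `c|e^†V_{K,τₛ∘σ}` in `b^∨`).
[cite: Milne1999LefschetzClasses, §2 p. 651 L5–L8 ("(α, β)† = (βᵗʳ, αᵗʳ)")] -/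
theorem Polarization.toMatrix_cornerRestrict_adjointBaseChange_flip
    (hcs : ∀ k l, A.restrictBlock K c hc ((τ s).comp (σ : F →ₐ[ℚ] F)) *
        MatrixAlgAction.unit (Q.transposeSplitting K A τ σ κ hτ hcard hros hσ hκ s ρ) k l =
      MatrixAlgAction.unit (Q.transposeSplitting K A τ σ κ hτ hcard hros hσ hκ s ρ) k l *
        A.restrictBlock K c hc ((τ s).comp (σ : F →ₐ[ℚ] F)))
    (hc's : ∀ k l, A.restrictBlock K (Q.adjointBaseChange K c) (Q.forall_baseChange_comp_adjointBaseChange_of_forall_comm K hc)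
        (τ s) * MatrixAlgAction.unit ρ k l =
      MatrixAlgAction.unit ρ k l *
        A.restrictBlock K (Q.adjointBaseChange K c) (Q.forall_baseChange_comp_adjointBaseChange_of_forall_comm K hc) (τ s)) :
    LinearMap.toMatrix b b (MatrixAlgAction.cornerRestrict i₀ _ hc's) =
      (LinearMap.toMatrix
        (pairingDualBasis _ (Q.isPerfPair_cornerPairing K A τ σ κ hτ hcard hros hσ hκ s ρ i₀) b)
        (pairingDualBasis _ (Q.isPerfPair_cornerPairing K A τ σ κ hτ hcard hros hσ hκ s ρ i₀) b)
        (MatrixAlgAction.cornerRestrict i₀ _ hcs))ᵀ := by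
  rw [Q.cornerRestrict_adjointBaseChange_eq_pairingTranspose_flip K A τ σ κ hτ hcard hros hσ hκ s ρ i₀ hc hcs hc's]
  exact toMatrix_pairingTranspose_flip _ (Q.isPerfPair_cornerPairing K A τ σ κ hτ hcard hros hσ hκ s ρ i₀) b _

end OnePair

/-! ## §3 All pairs: re-indexing `K ⊗ V = ⊕_{s ∈ Φ} (V_{K,τₛ} ⊕ V_{K,τₛ∘σ})` by `Φ ⊕ Φ`,
`C(H)(K) ≃ₐ[K] ∏_{s ∈ Φ} (End_K(eV_{K,τₛ}) × End_K(e^†V_{K,τₛ∘σ}))` carrying `†` to `(α, β) ↦ (βᵀ, αᵀ)` -/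

section Pairs

omit [Fintype S] in
/-- **The embeddings of the pairs, indexed by `Φ ⊕ Φ`**: `inl s ↦ τₛ`, `inr s ↦ τₛ ∘ σ` (Milne's `K_σ = k^al × k^al`: the two
extensions of `σ : F → k^al` to the CM centre). [cite: Milne1999LefschetzClasses, §2 p. 650 L26–L31 ("Let σ₁, σ₂ : L → k^al be the extensions of σ to L. Then V_σ = V_{σ₁} ⊕ V_{σ₂}") and p. 651 L29–L47] -/
def pairEmbedding : Φ ⊕ Φ → (F →ₐ[ℚ] K) :=
  Sum.elim (fun s => τ s) fun s => (τ (s : S)).comp (σ : F →ₐ[ℚ] F)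

omit [Fintype S] in
/-- `pairEmbedding (inl s) = τₛ`. [cite: Milne1999LefschetzClasses, §2 p. 651 L29–L47] -/
@[simp] theorem pairEmbedding_inl (s : Φ) : pairEmbedding K τ σ Φ (.inl s) = τ s := rfl

omit [Fintype S] in
/-- `pairEmbedding (inr s) = τₛ ∘ σ`. [cite: Milne1999LefschetzClasses, §2 p. 651 L29–L47] -/
@[simp] theorem pairEmbedding_inr (s : Φ) : pairEmbedding K τ σ Φ (.inr s) = (τ (s : S)).comp (σ : F →ₐ[ℚ] F) := rfl

omit [Fintype S] in
include hσ in
/-- `(χ ∘ σ) ∘ σ = χ` for the involution `σ` (plumbing). [cite: Milne1999LefschetzClasses, §2 p. 650 L26 ("the extensions of σ to L")] -/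
theorem comp_involution_comp_involution (χ : F →ₐ[ℚ] K) : (χ.comp (σ : F →ₐ[ℚ] F)).comp (σ : F →ₐ[ℚ] F) = χ :=
  AlgHom.ext fun a => by simp [hσ a]

omit [Fintype S] in
include hτ hσ hκ in
/-- **The index involution is an involution: `κ (κ s) = s`** (`τ_{κκs} = τₛ ∘ σ ∘ σ = τₛ` and `τ` is injective).
[cite: Milne1999LefschetzClasses, §2 p. 650 L26–L31] -/
theorem partnerIndex_partnerIndex (s : S) : κ (κ s) = s :=
  hτ (by rw [hκ, hκ, comp_involution_comp_involution K σ hσ])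

omit [Fintype S] in
include hτ hσ hκ hΦ₂ in
/-- **The `2·card Φ` embeddings `τₛ`, `τₛ ∘ σ` (`s ∈ Φ`) are pairwise distinct** (`τₛ ∘ σ = τ_{κs}` with `κs ∉ Φ`).
[cite: Milne1999LefschetzClasses, §2 p. 651 L29–L47 ("K ⊗_ℚ k^al = ∏_σ K_σ, K_σ = E ⊗_{F,σ} k^al")] -/
theorem pairEmbedding_injective : Injective (pairEmbedding K τ σ Φ) := by
  rintro (s | s) (t | t) h
  · simp only [pairEmbedding_inl] at h
    rw [Subtype.ext (hτ h)]
  · simp only [pairEmbedding_inl, pairEmbedding_inr, ← hκ] at h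
    exact (hΦ₂ t t.2 (hτ h ▸ s.2)).elim
  · simp only [pairEmbedding_inl, pairEmbedding_inr, ← hκ] at h
    exact (hΦ₂ s s.2 ((hτ h).symm ▸ t.2)).elim
  · simp only [pairEmbedding_inr] at h
    have h' := congrArg (fun χ : F →ₐ[ℚ] K => χ.comp (σ : F →ₐ[ℚ] F)) h
    simp only [comp_involution_comp_involution K σ hσ] at h'
    rw [Subtype.ext (hτ h')]

omit [Fintype S] in
include hΦ₁ hΦ₂ in
/-- **`Φ ⊕ Φ ≃ S`, `inl s ↦ s`, `inr s ↦ κ s`**: a set `Φ` of representatives of the pairs `{s, κs}` together with its partners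
exhausts the index set. [cite: Milne1999LefschetzClasses, §2 p. 651 L29–L47] -/
def pairIndexEquiv [DecidableEq S] (hκκ : ∀ s, κ (κ s) = s) : Φ ⊕ Φ ≃ S where
  toFun := Sum.elim (fun s => (s : S)) fun s => κ s
  invFun t := if h : t ∈ Φ then .inl ⟨t, h⟩ else .inr ⟨κ t, (hΦ₁ t).resolve_left h⟩
  left_inv u := by
    rcases u with s | s
    · simp [s.2]
    · simp [hΦ₂ s s.2, hκκ]
  right_inv t := by
    by_cases h : t ∈ Φ
    · simp [h]
    · simp [h, hκκ]

include hτ hcard hσ hκ hΦ₁ hΦ₂ in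
/-- **`card (Φ ⊕ Φ) = [F:ℚ]`** (`2·card Φ = card S = [F:ℚ]`: Milne's `2f` embeddings of the CM centre grouped in `f` pairs).
[cite: Milne1999LefschetzClasses, §2 p. 651 L29–L47] -/
theorem card_sum_eq_finrank : Fintype.card (Φ ⊕ Φ) = finrank ℚ F := by
  classical
  rw [← hcard]
  exact Fintype.card_congr (pairIndexEquiv κ Φ hΦ₁ hΦ₂ (partnerIndex_partnerIndex K τ σ κ hτ hσ hκ))

variable (ρ : ∀ s : Φ, Matrix ι ι K →ₐ[K] A.BlockEnd K (τ s))
  (hρ : ∀ s : Φ, Submodule.span K (Set.range (A.blockOp K hcent (τ s))) = LinearMap.range (ρ s).toLinearMap) (i₀ : ι)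

include hτ hcard hros hσ hκ in
/-- **The splittings of all `2·card Φ` blocks: `ρₛ` on `V_{K,τₛ}` and the compatible `ρₛ^†` on `V_{K,τₛ∘σ}`** — Milne's
"compatible isomorphisms `E_σ → Ē = M_d × M_d`", one for each pair. [cite: Milne1999LefschetzClasses, §2 p. 651 L57–L64] -/
def Polarization.pairSplitting : ∀ u : Φ ⊕ Φ, Matrix ι ι K →ₐ[K] A.BlockEnd K (pairEmbedding K τ σ Φ u) :=
  fun u => Sum.rec (motive := fun u => Matrix ι ι K →ₐ[K] A.BlockEnd K (pairEmbedding K τ σ Φ u))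
    (fun s => ρ s) (fun s => Q.transposeSplitting K A τ σ κ hτ hcard hros hσ hκ s (ρ s)) u

/-- `pairSplitting (inl s) = ρₛ`. [cite: Milne1999LefschetzClasses, §2 p. 651 L57–L64] -/
@[simp] theorem Polarization.pairSplitting_inl (s : Φ) :
    Q.pairSplitting K A τ σ κ Φ hτ hcard hros hσ hκ ρ (.inl s) = ρ s := rfl

/-- `pairSplitting (inr s) = ρₛ^†`. [cite: Milne1999LefschetzClasses, §2 p. 651 L57–L64] -/
@[simp] theorem Polarization.pairSplitting_inr (s : Φ) :
    Q.pairSplitting K A τ σ κ Φ hτ hcard hros hσ hκ ρ (.inr s) = Q.transposeSplitting K A τ σ κ hτ hcard hros hσ hκ s (ρ s) := rfl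

include hρ in
/-- Every `pairSplitting u` IS a splitting of its block (`ρₛ` by hypothesis, `ρₛ^†` by the seat's
`span_blockOp_eq_range_transposeSplitting`). [cite: Milne1999LefschetzClasses, §2 p. 651 L57–L64] -/
theorem Polarization.span_blockOp_pairEmbedding_eq_range :
    ∀ u : Φ ⊕ Φ, Submodule.span K (Set.range (A.blockOp K hcent (pairEmbedding K τ σ Φ u))) =
      LinearMap.range (Q.pairSplitting K A τ σ κ Φ hτ hcard hros hσ hκ ρ u).toLinearMap
  | .inl s => hρ s
  | .inr s => Q.span_blockOp_eq_range_transposeSplitting K A τ σ κ hτ hcard hros hσ hκ hcent s (ρ s) (hρ s)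

/-- **`†` restricted to `C(H)(K)`**: "`C(A)` is a `k`-algebra stable under the involution `†`" (on `K`-points: `c†` commutes with
`E_φ ⊗ K` because `E_φ† = E_φ`). [cite: Milne1999LefschetzClasses, §1 p. 643 L5–L6] -/
def Polarization.centralizerAdjoint
    (c : Subalgebra.centralizer K ((fun a : Module.End ℚ V => a.baseChange K) '' (H.endAlg : Set (Module.End ℚ V)))) :
    Subalgebra.centralizer K ((fun a : Module.End ℚ V => a.baseChange K) '' (H.endAlg : Set (Module.End ℚ V))) :=
  ⟨Q.adjointBaseChange K (c : Module.End K (K ⊗[ℚ] V)), by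
    rw [Subalgebra.mem_centralizer_iff]
    rintro _ ⟨a, ha, rfl⟩
    exact Q.forall_baseChange_comp_adjointBaseChange_of_forall_comm K
      (fun b => baseChange_mul_eq_of_mem_centralizer K c.2 b.2) ⟨a, ha⟩⟩

/-- `(c† : End_K(K ⊗ V)) = c†`. [cite: Milne1999LefschetzClasses, §1 p. 643 L5–L6] -/
@[simp] theorem Polarization.coe_centralizerAdjoint
    (c : Subalgebra.centralizer K ((fun a : Module.End ℚ V => a.baseChange K) '' (H.endAlg : Set (Module.End ℚ V)))) :
    (Q.centralizerAdjoint K c : Module.End K (K ⊗[ℚ] V)) = Q.adjointBaseChange K (c : Module.End K (K ⊗[ℚ] V)) :=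
  rfl

/-- **`†` is an involution of `C(H)(K)`**: `c†† = c`. [cite: Milne1999LefschetzClasses, §1 p. 642 L70 ("β ↦ β† is an involution") and p. 643 L5–L6] -/
theorem Polarization.centralizerAdjoint_centralizerAdjoint
    (c : Subalgebra.centralizer K ((fun a : Module.End ℚ V => a.baseChange K) '' (H.endAlg : Set (Module.End ℚ V)))) :
    Q.centralizerAdjoint K (Q.centralizerAdjoint K c) = c :=
  Subtype.ext (Q.adjointBaseChange_adjointBaseChange K _)

/-- **`†` is anti-multiplicative on `C(H)(K)`**: `(c d)† = d† c†`. [cite: Milne1999LefschetzClasses, §1 p. 642 L70 ("an involution of the k-algebra End_k(V(A))")] -/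
theorem Polarization.centralizerAdjoint_mul
    (c d : Subalgebra.centralizer K ((fun a : Module.End ℚ V => a.baseChange K) '' (H.endAlg : Set (Module.End ℚ V)))) :
    Q.centralizerAdjoint K (c * d) = Q.centralizerAdjoint K d * Q.centralizerAdjoint K c :=
  Subtype.ext (Q.adjointBaseChange_mul K _ _)

include hΦ₁ hΦ₂ hρ in
/-- **Milne's "`C(A) ⊗_k k^al = ∏_σ C_σ`, `C_σ ≈ End_Ē(V̄) ≈ M_{g/fd}(k^al) × M_{g/fd}(k^al)`", pair by pair:
`C(H)(K) ≃ₐ[K] ∏_{s ∈ Φ} (End_K(e V_{K,τₛ}) × End_K(e^† V_{K,τₛ∘σ}))`, `c ↦ (c|eV_{K,τₛ}, c|e^†V_{K,τₛ∘σ})_s`** — the seat's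
`EndAction.centralizerBaseChangeAlgEquivCornerBlocks` for the `2·card Φ` blocks indexed by `Φ ⊕ Φ` with the compatible
splittings `(ρₛ, ρₛ^†)`, regrouped in pairs. [cite: Milne1999LefschetzClasses, §2 p. 651 L57–L70] -/
def Polarization.centralizerBaseChangeAlgEquivCornerPairs :
    Subalgebra.centralizer K ((fun a : Module.End ℚ V => a.baseChange K) '' (H.endAlg : Set (Module.End ℚ V))) ≃ₐ[K]
      ∀ s : Φ, Module.End K (MatrixAlgAction.corner (ρ s) i₀) ×
        Module.End K (MatrixAlgAction.corner (Q.transposeSplitting K A τ σ κ hτ hcard hros hσ hκ s (ρ s)) i₀) :=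
  (A.centralizerBaseChangeAlgEquivCornerBlocks K (pairEmbedding K τ σ Φ) (pairEmbedding_injective K τ σ κ Φ hτ hσ hκ hΦ₂)
      (card_sum_eq_finrank K τ σ κ Φ hτ hcard hσ hκ hΦ₁ hΦ₂) hcent (fun _ => i₀)
      (Q.pairSplitting K A τ σ κ Φ hτ hcard hros hσ hκ ρ)
      (Q.span_blockOp_pairEmbedding_eq_range K A τ σ κ Φ hτ hcard hros hσ hκ hcent ρ hρ)).trans
    (sumPiAlgEquivPiProd K fun u =>
      Module.End K (MatrixAlgAction.corner (Q.pairSplitting K A τ σ κ Φ hτ hcard hros hσ hκ ρ u) i₀))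

/-- The first component IS restriction to `e V_{K,τₛ}`: `((Ψ c)ₛ.1 x : K ⊗ V) = c x`. [cite: Milne1999LefschetzClasses, §2 p. 651 L64–L70 and Remark 2.3] -/
@[simp] theorem Polarization.coe_centralizerBaseChangeAlgEquivCornerPairs_apply_fst
    (c : Subalgebra.centralizer K ((fun a : Module.End ℚ V => a.baseChange K) '' (H.endAlg : Set (Module.End ℚ V))))
    (s : Φ) (x : MatrixAlgAction.corner (ρ s) i₀) :
    ((((Q.centralizerBaseChangeAlgEquivCornerPairs K A τ σ κ Φ hτ hcard hros hσ hκ hΦ₁ hΦ₂ hcent ρ hρ i₀ c s).1 x :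
        MatrixAlgAction.corner (ρ s) i₀) : A.eigenspaceBaseChange K (τ s)) : K ⊗[ℚ] V) = (c : Module.End K (K ⊗[ℚ] V)) x :=
  rfl

/-- The second component IS restriction to `e^† V_{K,τₛ∘σ}`: `((Ψ c)ₛ.2 y : K ⊗ V) = c y`. [cite: Milne1999LefschetzClasses, §2 p. 651 L64–L70 and Remark 2.3] -/
@[simp] theorem Polarization.coe_centralizerBaseChangeAlgEquivCornerPairs_apply_snd
    (c : Subalgebra.centralizer K ((fun a : Module.End ℚ V => a.baseChange K) '' (H.endAlg : Set (Module.End ℚ V))))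
    (s : Φ) (y : MatrixAlgAction.corner (Q.transposeSplitting K A τ σ κ hτ hcard hros hσ hκ s (ρ s)) i₀) :
    ((((Q.centralizerBaseChangeAlgEquivCornerPairs K A τ σ κ Φ hτ hcard hros hσ hκ hΦ₁ hΦ₂ hcent ρ hρ i₀ c s).2 y :
        MatrixAlgAction.corner (Q.transposeSplitting K A τ σ κ hτ hcard hros hσ hκ s (ρ s)) i₀) :
          A.eigenspaceBaseChange K ((τ (s : S)).comp (σ : F →ₐ[ℚ] F))) : K ⊗[ℚ] V) =
      (c : Module.End K (K ⊗[ℚ] V)) y :=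
  rfl

/-- **Milne's "`(α, β)† = (βᵗʳ, αᵗʳ)`": under `C(H)(K) ≃ₐ ∏_{s ∈ Φ} (End_K(eV₁) × End_K(e^†V₂))` the involution `†` becomes
`(f, g) ↦ (gᵀ, fᵀ)`** — transposes across the corner pairing `Q_K : eV_{K,τₛ} × e^†V_{K,τₛ∘σ} → K` and its flip.
[cite: Milne1999LefschetzClasses, §2 p. 651 L5–L8 ("(α, β)† = (βᵗʳ, αᵗʳ)") and L57–L64 ("compatible isomorphisms E_σ → Ē … carries the Rosati involution on E_σ into the involution † on Ē")] -/
theorem Polarization.centralizerBaseChangeAlgEquivCornerPairs_centralizerAdjoint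
    (c : Subalgebra.centralizer K ((fun a : Module.End ℚ V => a.baseChange K) '' (H.endAlg : Set (Module.End ℚ V))))
    (s : Φ) :
    Q.centralizerBaseChangeAlgEquivCornerPairs K A τ σ κ Φ hτ hcard hros hσ hκ hΦ₁ hΦ₂ hcent ρ hρ i₀ (Q.centralizerAdjoint K c) s =
      (pairingTranspose (Q.cornerPairing K A τ σ κ hτ hcard hros hσ hκ s (ρ s) i₀).flip
          (Q.isPerfPair_cornerPairing K A τ σ κ hτ hcard hros hσ hκ s (ρ s) i₀).flip
          (Q.centralizerBaseChangeAlgEquivCornerPairs K A τ σ κ Φ hτ hcard hros hσ hκ hΦ₁ hΦ₂ hcent ρ hρ i₀ c s).2,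
        pairingTranspose (Q.cornerPairing K A τ σ κ hτ hcard hros hσ hκ s (ρ s) i₀)
          (Q.isPerfPair_cornerPairing K A τ σ κ hτ hcard hros hσ hκ s (ρ s) i₀)
          (Q.centralizerBaseChangeAlgEquivCornerPairs K A τ σ κ Φ hτ hcard hros hσ hκ hΦ₁ hΦ₂ hcent ρ hρ i₀ c s).1) := by
  refine Prod.ext ?_ ?_
  · refine pairingTranspose_unique (Q.cornerPairing K A τ σ κ hτ hcard hros hσ hκ s (ρ s) i₀).flip (Q.isPerfPair_cornerPairing K A τ σ κ hτ hcard hros hσ hκ s (ρ s) i₀).flip fun y x => ?_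
    rw [LinearMap.flip_apply, LinearMap.flip_apply, Q.cornerPairing_apply K A τ σ κ hτ hcard hros hσ hκ s (ρ s) i₀, Q.cornerPairing_apply K A τ σ κ hτ hcard hros hσ hκ s (ρ s) i₀,
      Q.coe_centralizerBaseChangeAlgEquivCornerPairs_apply_fst K A τ σ κ Φ hτ hcard hros hσ hκ hΦ₁ hΦ₂ hcent ρ hρ i₀, Q.coe_centralizerBaseChangeAlgEquivCornerPairs_apply_snd K A τ σ κ Φ hτ hcard hros hσ hκ hΦ₁ hΦ₂ hcent ρ hρ i₀,
      Q.coe_centralizerAdjoint K]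
    exact Q.baseChange_form_adjointBaseChange_apply K _ _ _
  · refine pairingTranspose_unique (Q.cornerPairing K A τ σ κ hτ hcard hros hσ hκ s (ρ s) i₀) (Q.isPerfPair_cornerPairing K A τ σ κ hτ hcard hros hσ hκ s (ρ s) i₀) fun x y => ?_
    rw [Q.cornerPairing_apply K A τ σ κ hτ hcard hros hσ hκ s (ρ s) i₀, Q.cornerPairing_apply K A τ σ κ hτ hcard hros hσ hκ s (ρ s) i₀, Q.coe_centralizerBaseChangeAlgEquivCornerPairs_apply_fst K A τ σ κ Φ hτ hcard hros hσ hκ hΦ₁ hΦ₂ hcent ρ hρ i₀,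
      Q.coe_centralizerBaseChangeAlgEquivCornerPairs_apply_snd K A τ σ κ Φ hτ hcard hros hσ hκ hΦ₁ hΦ₂ hcent ρ hρ i₀, Q.coe_centralizerAdjoint K]
    exact Q.baseChange_form_apply_adjointBaseChange K _ _ _

/-! ## §4 In dual bases: `C(H)(K) ≃ₐ[K] ∏_{s ∈ Φ} (M_m(K) × M_m(K))` with `Ψ(c†)ₛ = ((Ψ c)ₛ.2ᵀ, (Ψ c)ₛ.1ᵀ)`; outright over an
algebraically closed `K` -/

variable {m : Type*} [Fintype m] [DecidableEq m] (b : ∀ s : Φ, Module.Basis m K (MatrixAlgAction.corner (ρ s) i₀))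

include hτ hcard hros hσ hκ hΦ₁ hΦ₂ hρ in
/-- **`C(H)(K) ≃ₐ[K] ∏_{s ∈ Φ} (M_m(K) × M_m(K))`** in the bases `bₛ` of `eV_{K,τₛ}` and their DUAL bases `bₛ^∨` of `e^†V_{K,τₛ∘σ}`
— Milne's "`C_σ ≈ M_{g/fd}(k^al) × M_{g/fd}(k^al)`". [cite: Milne1999LefschetzClasses, §2 p. 651 L64–L70] -/
def Polarization.centralizerBaseChangeAlgEquivMatrixPairs :
    Subalgebra.centralizer K ((fun a : Module.End ℚ V => a.baseChange K) '' (H.endAlg : Set (Module.End ℚ V))) ≃ₐ[K]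
      ∀ _ : Φ, Matrix m m K × Matrix m m K :=
  (Q.centralizerBaseChangeAlgEquivCornerPairs K A τ σ κ Φ hτ hcard hros hσ hκ hΦ₁ hΦ₂ hcent ρ hρ i₀).trans
    (AlgEquiv.piCongrRight fun s =>
      AlgEquiv.prodCongr (LinearMap.toMatrixAlgEquiv (b s))
        (LinearMap.toMatrixAlgEquiv
          (pairingDualBasis _ (Q.isPerfPair_cornerPairing K A τ σ κ hτ hcard hros hσ hκ s (ρ s) i₀) (b s))))

/-- Unfolding: `(Ψ_mat c)ₛ = (M_{bₛ}((Ψ c)ₛ.1), M_{bₛ^∨}((Ψ c)ₛ.2))`. [cite: Milne1999LefschetzClasses, §2 p. 651 L64–L70] -/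
theorem Polarization.centralizerBaseChangeAlgEquivMatrixPairs_apply
    (c : Subalgebra.centralizer K ((fun a : Module.End ℚ V => a.baseChange K) '' (H.endAlg : Set (Module.End ℚ V))))
    (s : Φ) :
    Q.centralizerBaseChangeAlgEquivMatrixPairs K A τ σ κ Φ hτ hcard hros hσ hκ hΦ₁ hΦ₂ hcent ρ hρ i₀ b c s =
      (LinearMap.toMatrix (b s) (b s)
          (Q.centralizerBaseChangeAlgEquivCornerPairs K A τ σ κ Φ hτ hcard hros hσ hκ hΦ₁ hΦ₂ hcent ρ hρ i₀ c s).1,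
        LinearMap.toMatrix
          (pairingDualBasis _ (Q.isPerfPair_cornerPairing K A τ σ κ hτ hcard hros hσ hκ s (ρ s) i₀) (b s))
          (pairingDualBasis _ (Q.isPerfPair_cornerPairing K A τ σ κ hτ hcard hros hσ hκ s (ρ s) i₀) (b s))
          (Q.centralizerBaseChangeAlgEquivCornerPairs K A τ σ κ Φ hτ hcard hros hσ hκ hΦ₁ hΦ₂ hcent ρ hρ i₀ c s).2) :=
  rfl

/-- **Milne: "`C(A) ⊗_k k^al = ∏ C_σ`, `C_σ ≈ M_{g/fd}(k^al) × M_{g/fd}(k^al)`" with "`(α, β)† = (βᵗʳ, αᵗʳ)`": in dual bases of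
the corners, `Ψ(c†)ₛ = ((Ψ c)ₛ.2ᵀ, (Ψ c)ₛ.1ᵀ)` for every `c ∈ C(H)(K)`.**
[cite: Milne1999LefschetzClasses, §2 p. 651 L5–L8 and L57–L70] -/
theorem Polarization.centralizerBaseChangeAlgEquivMatrixPairs_centralizerAdjoint
    (c : Subalgebra.centralizer K ((fun a : Module.End ℚ V => a.baseChange K) '' (H.endAlg : Set (Module.End ℚ V))))
    (s : Φ) :
    Q.centralizerBaseChangeAlgEquivMatrixPairs K A τ σ κ Φ hτ hcard hros hσ hκ hΦ₁ hΦ₂ hcent ρ hρ i₀ b (Q.centralizerAdjoint K c) s =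
      ((Q.centralizerBaseChangeAlgEquivMatrixPairs K A τ σ κ Φ hτ hcard hros hσ hκ hΦ₁ hΦ₂ hcent ρ hρ i₀ b c s).2ᵀ,
        (Q.centralizerBaseChangeAlgEquivMatrixPairs K A τ σ κ Φ hτ hcard hros hσ hκ hΦ₁ hΦ₂ hcent ρ hρ i₀ b c s).1ᵀ) := by
  rw [Q.centralizerBaseChangeAlgEquivMatrixPairs_apply K A τ σ κ Φ hτ hcard hros hσ hκ hΦ₁ hΦ₂ hcent ρ hρ i₀ b, Q.centralizerBaseChangeAlgEquivMatrixPairs_apply K A τ σ κ Φ hτ hcard hros hσ hκ hΦ₁ hΦ₂ hcent ρ hρ i₀ b,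
    Q.centralizerBaseChangeAlgEquivCornerPairs_centralizerAdjoint K A τ σ κ Φ hτ hcard hros hσ hκ hΦ₁ hΦ₂ hcent ρ hρ i₀]
  exact Prod.ext
    (toMatrix_pairingTranspose_flip (Q.cornerPairing K A τ σ κ hτ hcard hros hσ hκ s (ρ s) i₀)
      (Q.isPerfPair_cornerPairing K A τ σ κ hτ hcard hros hσ hκ s (ρ s) i₀) (b s) _)
    (toMatrix_pairingTranspose (Q.cornerPairing K A τ σ κ hτ hcard hros hσ hκ s (ρ s) i₀)
      (Q.isPerfPair_cornerPairing K A τ σ κ hτ hcard hros hσ hκ s (ρ s) i₀) (b s) _)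

end Pairs

/-! ### Outright over an algebraically closed `K` -/

section Existence

include hτ hcard hros hσ hκ hΦ₁ hΦ₂ hcent in
/-- **Milne's type IV centralizer algebra WITH INVOLUTION over an algebraically closed field, outright:
`∃ Ψ : C(H)(K) ≃ₐ[K] ∏_{s ∈ Φ} (M_m(K) × M_m(K))`, `m = dim_ℚ V / ([F:ℚ]·d)`, `d²·[F:ℚ] = dim_ℚ E_φ`, such that
`Ψ(c†)ₛ = ((Ψ c)ₛ.2ᵀ, (Ψ c)ₛ.1ᵀ)` for all `c`** — for `E_φ` simple with centre exactly the central `ι(F)`, the Rosati condition,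
`K` algebraically closed with all `[F:ℚ]` embeddings `τ`, representatives `Φ` of the pairs `{τₛ, τₛ ∘ σ}`: "for each `σ`, there
exist compatible isomorphisms `E_σ → Ē` … Consequently, `C(A) ⊗_k k^al = ∏ C_σ` where
`C_σ ≈ End_Ē(V̄) ≈ M_{g/fd}(k^al) × M_{g/fd}(k^al)`" with "`(α, β)† = (βᵗʳ, αᵗʳ)`" (the splittings from the seat's
`EndAction.exists_matrixAlgHom_span_blockOp_eq_range`, re-indexed to a common size `d`, their compatible partners `ρₛ^†`, a basis
of each corner `eV_{K,τₛ}` — of dimension `g/(df)` — and its dual basis).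
[cite: Milne1999LefschetzClasses, §2 p. 651 L5–L8 and L57–L70] -/
theorem Polarization.exists_centralizer_algEquiv_matrixPairs_adjoint [IsAlgClosed K] [IsSimpleRing H.endAlg]
    (hcen : ∀ z ∈ H.endAlg, (∀ a ∈ H.endAlg, a * z = z * a) → z ∈ Set.range A.ι) :
    ∃ d : ℕ, NeZero d ∧ d ^ 2 * finrank ℚ F = finrank ℚ H.endAlg ∧ d ∣ finrank ℚ V / finrank ℚ F ∧
      ∃ Ψ : Subalgebra.centralizer K ((fun a : Module.End ℚ V => a.baseChange K) '' (H.endAlg : Set (Module.End ℚ V))) ≃ₐ[K]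
          ∀ _ : Φ, Matrix (Fin (finrank ℚ V / finrank ℚ F / d)) (Fin (finrank ℚ V / finrank ℚ F / d)) K ×
            Matrix (Fin (finrank ℚ V / finrank ℚ F / d)) (Fin (finrank ℚ V / finrank ℚ F / d)) K,
        ∀ c s, Ψ (Q.centralizerAdjoint K c) s = ((Ψ c s).2ᵀ, (Ψ c s).1ᵀ) := by
  classical
  -- a representative exists: `card S = [F:ℚ] > 0`
  obtain ⟨s₀⟩ : Nonempty S := Fintype.card_pos_iff.1 (hcard ▸ Module.finrank_pos)
  obtain ⟨t, ht⟩ : ∃ t, t ∈ Φ := (hΦ₁ s₀).elim (fun h => ⟨s₀, h⟩) fun h => ⟨κ s₀, h⟩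
  -- splittings of the representative blocks, all of the same size `d`
  choose dρ hdρ hdimρ ρ₀ hρ₀ using fun s : Φ => A.exists_matrixAlgHom_span_blockOp_eq_range K hcent hcen (τ s)
  set d := dρ ⟨t, ht⟩ with hd
  have hdeq : ∀ s, dρ s = d := fun s =>
    Nat.pow_left_injective two_ne_zero (Nat.eq_of_mul_eq_mul_right Module.finrank_pos ((hdimρ s).trans (hdimρ _).symm))
  -- re-index every splitting to `Fin d`
  let e : ∀ s : Φ, Matrix (Fin d) (Fin d) K ≃ₐ[K] Matrix (Fin (dρ s)) (Fin (dρ s)) K := fun s =>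
    Matrix.reindexAlgEquiv K K (finCongr (hdeq s).symm)
  let ρ : ∀ s : Φ, Matrix (Fin d) (Fin d) K →ₐ[K] A.BlockEnd K (τ s) := fun s => (ρ₀ s).comp (e s : _ →ₐ[K] _)
  have hρ : ∀ s : Φ, Submodule.span K (Set.range (A.blockOp K hcent (τ s))) = LinearMap.range (ρ s).toLinearMap := fun s => by
    rw [hρ₀ s]
    change _ = LinearMap.range ((ρ₀ s).toLinearMap ∘ₗ (e s).toLinearEquiv.toLinearMap)
    rw [LinearMap.range_comp_of_range_eq_top _ (LinearMap.range_eq_top.2 (e s).toLinearEquiv.surjective)]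
  have hdpos : 0 < d := Nat.pos_of_ne_zero (hdρ ⟨t, ht⟩).out
  -- the count `d · dim eV_{K,τₛ} = dim_ℚ V / [F:ℚ]`
  have hcnt : ∀ s : Φ, d * finrank K (MatrixAlgAction.corner (ρ s) (0 : Fin d)) = finrank ℚ V / finrank ℚ F := fun s => by
    have h := A.card_mul_finrank_corner_eq_div K τ Φ hτ hcard (fun _ => (0 : Fin d)) ρ s
    rwa [Fintype.card_fin] at h
  have hdim : ∀ s : Φ, finrank K (MatrixAlgAction.corner (ρ s) (0 : Fin d)) = finrank ℚ V / finrank ℚ F / d := fun s =>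
    (Nat.div_eq_of_eq_mul_left hdpos ((hcnt s).symm.trans (mul_comm _ _))).symm
  let b : ∀ s : Φ, Module.Basis (Fin (finrank ℚ V / finrank ℚ F / d)) K (MatrixAlgAction.corner (ρ s) (0 : Fin d)) := fun s =>
    Module.finBasisOfFinrankEq K _ (hdim s)
  exact ⟨d, hdρ _, hdimρ _, Dvd.intro _ (hcnt ⟨t, ht⟩),
    Q.centralizerBaseChangeAlgEquivMatrixPairs K A τ σ κ Φ hτ hcard hros hσ hκ hΦ₁ hΦ₂ hcent ρ hρ 0 b,
    fun c s => Q.centralizerBaseChangeAlgEquivMatrixPairs_centralizerAdjoint K A τ σ κ Φ hτ hcard hros hσ hκ hΦ₁ hΦ₂ hcent ρ hρ 0 b c s⟩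

end Existence

end HodgeStructure

end Literature.AlgebraicGeometry.Motives
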